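import Summits.AnomalousDissipation.AnomalousDissipation.Theses.DebrisQuanta
import Summits.AnomalousDissipation.AnomalousDissipation.Theorems.DebrisQuantaRobustDecayQuantumRecord
import Literature.Analysis.FluidPDE.DuchonRobertLionsCounterexample
import Literature.Analysis.FluidPDE.LogLipschitzKernelBounds
import Literature.Analysis.FunctionSpaces.FlatTorusProofs
import Literature.Analysis.FunctionSpaces.TorusFourierCalculus

/-!
# Refutation of `DebrisQuanta.RobustDecayQuantum` (stmt-AnomalousDissipation-2859): the `t = 0` slice is junk

(Repair 2026-08-16: the route dropped the item, so the refuted constant is re-declared, original name and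
definiens, in `Theorems/DebrisQuantaRobustDecayQuantumRecord.lean`, imported above; theorem unchanged.)

`RobustDecayQuantum` (route `AnomalousDissipation/DebrisQuanta`) quantifies over vanishing-viscosity families of
global Leray–Hopf solutions `u j` (`Torus.IsGlobalLerayHopf`) and debris times `t j ≥ 0` at which the slice
`u j (t j)` is `L²`-close to `b j + D_{α,W}(· − a j)`, and concludes an eventual uniform burn `≥ q > 0` on
`[t j, t j + 1]`. No clause of `Torus.IsLerayHopfOn` pins the slice `u 0` to the datum (weak form, `energy_bound`,
`memL2Sobolev`, `energy_ineq_ae` see `t > 0` only; `weak_continuous`/`strong_initial` live on `Ioc 0 T`/`𝓝[>] 0`;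
`memLp` and `energy_ineq_zero` at `0` ask `u 0 ∈ L²`, `E(u 0) ≤ E(u₀)` — the defect of the tree's
`not_lions_energy_equality`). So with `t j = 0` the "jump flow" (steady constant flow `c`, slice `t = 0` := the debris
profile `D`, `½‖c‖² = E(D)`) meets every hypothesis (`α = 5/6`, `W ≡ e₃`, `f = 0`, `M = c_tol = 0`,
`ν_j = 1/(j+1)`, `a j = 0`, `b j = 0`, `u₀ j = c`) and burns `ν_j ∫₀¹ ‖∇c‖² = 0 < q`. The only analysis is
`D_{5/6,e₃} ∈ L²(T³)`: `‖curl Φ‖ ≤ 4‖DΦ‖`, `‖DΦ(z)‖ ≤ (1/6)|z|^{-5/6}` on `0 < |z| < 1/8`, `DΦ` bounded on the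
shell `1/8 ≤ |z| ≤ 2`, `∫_{B(ctr,2)} |y − ctr|^{-5/3} < ∞`, transported by the measure-preserving `Torus.repr`.
FIX (route repair): add `∀ j, u j 0 = u₀ j` to the family (or require `0 < t j`); `RecurrentDebris`,
`DecayQuantumWeak`, `InstantBurnNeedsConcentration` are unaffected (data enter through `u₀`; visits at `t > 0` are
pinned by weak continuity). Route review 2026-08-15, refuter-rreview-route-AnomalousDissipati-a258b335-0.
-/

namespace Summit.AnomalousDissipation.AnomalousDissipation.Theorems
open scoped BigOperators Topology ENNReal InnerProductSpace RealInnerProductSpace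
open Filter Set MeasureTheory Metric
open Literature.Analysis Literature.Analysis.FunctionSpaces Literature.Analysis.FluidPDE
/-- Refutes `DebrisQuanta.RobustDecayQuantum` (stmt-AnomalousDissipation-2859): with `α = 5/6`,
`W ≡ e₃`, `f = 0`, `M = c = 0`, no `q > 0` works, because the family "constant flow
`√(2E(D)) e₁` for `t ≠ 0`, debris profile `D = curl(χ(|z|)|z|^{1/6} e₃)` at the junk slice
`t = 0`", `ν_j = 1/(j+1)`, `t_j = 0`, is global Leray–Hopf from the constant datum, satisfies the
energy inequality from `t = 0`, meets the debris condition with tolerance `0`, and burns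
`ν_j ∫₀¹ ‖∇u_j‖² = 0`; witness: the jump flow (cf. `not_lions_energy_equality`). [folklore] -/
theorem DebrisQuantaRobustDecayQuantum_refuted :
    ¬ Summit.AnomalousDissipation.AnomalousDissipation.Theses.DebrisQuanta.RobustDecayQuantum := by
  -- unit vector `e₃`.
  set e3 : (EuclideanSpace ℝ (Fin 3)) := EuclideanSpace.single 2 1 with he3_def
  -- unit vector `e₁`.
  set e1 : (EuclideanSpace ℝ (Fin 3)) := EuclideanSpace.single 0 1 with he1_def
  -- The jump flow: constant field `c` for `t ≠ 0`, the field `g` at `t = 0`.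
  set jump : ((UnitAddTorus (Fin 3)) → (EuclideanSpace ℝ (Fin 3))) → (EuclideanSpace ℝ (Fin 3)) → ℝ → (UnitAddTorus (Fin 3)) → (EuclideanSpace ℝ (Fin 3)) := fun g c t x => if t = 0 then g x else c with hjump_def
  -- Off `t = 0` the jump flow is the constant flow.
  have jump_of_ne : ∀ {g : (UnitAddTorus (Fin 3)) → (EuclideanSpace ℝ (Fin 3))} {c : (EuclideanSpace ℝ (Fin 3))} {t : ℝ}, t ≠ 0 → jump g c t = fun _ => c := by
    intro g c t ht; funext x; simp [hjump_def, ht]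
  -- At `t = 0` the jump flow is the prescribed slice.
  have jump_zero : ∀ {g : (UnitAddTorus (Fin 3)) → (EuclideanSpace ℝ (Fin 3))} {c : (EuclideanSpace ℝ (Fin 3))}, jump g c 0 = g := by
    intro g c; funext x; simp [hjump_def]
  -- The jump flow is Leray–Hopf on `[0,T)` from the constant datum whenever the slice is in `L²` with no more kinetic energy (no clause of `Torus.IsLerayHopfOn` sees `u 0` otherwise; cf. `isLerayHopfOn_jumpFlow_of_pos`).
  have isLerayHopfOn_jump : ∀ {T : ℝ} (hT : 0 < T) (ν : ℝ) (c : (EuclideanSpace ℝ (Fin 3))) {g : (UnitAddTorus (Fin 3)) → (EuclideanSpace ℝ (Fin 3))} (hg : MemLp g 2 volume)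
      (hgc : Torus.kineticEnergy g ≤ Torus.kineticEnergy (fun _ : (UnitAddTorus (Fin 3)) => c)),
      Torus.IsLerayHopfOn T ν 0 (fun _ => c) (jump g c) := by
    intro T hT ν c g hg hgc
    have h := isLerayHopfOn_const hT ν c
    have hwork : ∀ (v : ℝ → (UnitAddTorus (Fin 3)) → (EuclideanSpace ℝ (Fin 3))) (a b : ℝ), ∫ τ in a..b, ∫ x, ⟪(0 : ℝ → (UnitAddTorus (Fin 3)) → (EuclideanSpace ℝ (Fin 3))) τ x, v τ x⟫ = 0 := by
      intro v a b; simp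
    have hdiss : ∀ {a b : ℝ}, 0 ≤ a → (∫⁻ τ in Ioo a b, Torus.eGradNormSq (jump g c τ)) =
        ∫⁻ τ in Ioo a b, Torus.eGradNormSq (fun _ : (UnitAddTorus (Fin 3)) => c) := fun ha =>
      setLIntegral_congr_fun measurableSet_Ioo fun τ hτ => by rw [jump_of_ne (ha.trans_lt hτ.1).ne']
    refine ⟨?_, ?_, ?_, ?_, ?_, ?_, ?_, ?_⟩
    · obtain ⟨hm, h2, hdiv, hid⟩ := h.weak
      refine ⟨?_, ?_, ?_, ?_⟩
      · refine hm.congr ((ae_restrict_iff' (measurableSet_Ioo.prod MeasurableSet.univ)).2 (ae_of_all _ ?_))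
        rintro ⟨t, y⟩ ⟨ht, -⟩
        simp [FunctionSpaces.Torus.stLift, hjump_def, (ne_of_gt ht.1 : t ≠ 0)]
      · refine lt_of_le_of_lt (le_of_eq ?_) h2
        exact setLIntegral_congr_fun measurableSet_Ioo fun t ht => by rw [jump_of_ne ht.1.ne']
      · filter_upwards [hdiv, ae_restrict_mem measurableSet_Ioo] with t h1 ht
        rw [jump_of_ne ht.1.ne']; exact h1
      · intro ψ hψ hψd
        convert hid ψ hψ hψd using 2
        exact setIntegral_congr_fun measurableSet_Ioo fun t ht => by rw [jump_of_ne ht.1.ne']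
    · obtain ⟨C, hC⟩ := h.energy_bound
      exact ⟨C, by
        filter_upwards [hC, ae_restrict_mem measurableSet_Ioo] with t h1 ht
        rw [jump_of_ne ht.1.ne']; exact h1⟩
    · intro t ht; rcases eq_or_ne t 0 with rfl | ht0
      · rw [jump_zero]; exact hg
      · rw [jump_of_ne ht0]; exact memLp_const _
    · obtain ⟨h1, h2⟩ := h.memL2Sobolev
      refine ⟨?_, ?_⟩
      · filter_upwards [h1, ae_restrict_mem measurableSet_Ioo] with t h1 ht
        rw [jump_of_ne ht.1.ne']; exact h1
      · refine lt_of_le_of_lt (le_of_eq ?_) h2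
        unfold FunctionSpaces.Torus.eL2SobolevNorm; congr 1
        exact setLIntegral_congr_fun measurableSet_Ioo fun t ht => by simp only [jump_of_ne ht.1.ne']
    · intro t ht
      rcases ht.1.eq_or_lt with rfl | ht0
      · rw [jump_zero, Ioo_self, Measure.restrict_empty, lintegral_zero_measure, ENNReal.toReal_zero,
          mul_zero, add_zero, intervalIntegral.integral_same, add_zero]
        exact hgc
      · have key := h.energy_ineq_zero t ht
        rw [hwork] at key
        rw [hwork, hdiss le_rfl, jump_of_ne ht0.ne']; exact key
    · filter_upwards [h.energy_ineq_ae, ae_restrict_mem measurableSet_Ioo] with s hs hsI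
      intro t ht
      have key := hs t ht
      rw [hwork] at key
      rw [hwork, hdiss hsI.1.le, jump_of_ne (hsI.1.trans_le ht.1).ne', jump_of_ne hsI.1.ne']; exact key
    · intro w hw
      obtain ⟨hc1, hc2⟩ := h.weak_continuous w hw
      refine ⟨hc1.congr fun t ht => by rw [jump_of_ne ht.1.ne'], ?_⟩
      exact hc2.congr' (by filter_upwards [self_mem_nhdsWithin] with t ht; rw [jump_of_ne (ne_of_gt ht)])
    · exact h.strong_initial.congr' (by
        filter_upwards [self_mem_nhdsWithin] with t ht; rw [jump_of_ne (ne_of_gt ht)])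
  -- The jump flow is a global Leray–Hopf solution.
  have isGlobalLerayHopf_jump : ∀ (ν : ℝ) (c : (EuclideanSpace ℝ (Fin 3))) {g : (UnitAddTorus (Fin 3)) → (EuclideanSpace ℝ (Fin 3))}, MemLp g 2 volume →
      Torus.kineticEnergy g ≤ Torus.kineticEnergy (fun _ : (UnitAddTorus (Fin 3)) => c) →
      Torus.IsGlobalLerayHopf ν 0 (fun _ => c) (jump g c) := fun ν c g hg hgc _ hT =>
    isLerayHopfOn_jump hT ν c hg hgc
  -- A constant field has `‖∇c‖₂² = 0` (derivative-based norm).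
  have gradNormSq_const : ∀ c : (EuclideanSpace ℝ (Fin 3)), Torus.gradNormSq (fun _ : (UnitAddTorus (Fin 3)) => c) = 0 := by
    intro c
    simp [Torus.gradNormSq, FunctionSpaces.Torus.partialDeriv, FunctionSpaces.Torus.lineDeriv]
  -- A constant field has spectral `‖∇c‖₂²` with real part `0` (via the proved `gradNormSq_eq_toReal_eGradNormSq`).
  have toReal_eGradNormSq_const : ∀ c : (EuclideanSpace ℝ (Fin 3)), (Torus.eGradNormSq (fun _ : (UnitAddTorus (Fin 3)) => c)).toReal = 0 := by
    intro c
    rw [← Torus.gradNormSq_eq_toReal_eGradNormSq_holds (Torus.isSmooth_const c), gradNormSq_const]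
  -- The jump flow burns nothing on any `(a,b)` with `a ≥ 0`.
  have toReal_lintegral_eGradNormSq_jump : ∀ {g : (UnitAddTorus (Fin 3)) → (EuclideanSpace ℝ (Fin 3))} (c : (EuclideanSpace ℝ (Fin 3))) {a b : ℝ} (ha : 0 ≤ a),
      (∫⁻ τ in Ioo a b, Torus.eGradNormSq (jump g c τ)).toReal = 0 := by
    intro g c a b ha
    have : (∫⁻ τ in Ioo a b, Torus.eGradNormSq (jump g c τ)) = ∫⁻ τ in Ioo a b, Torus.eGradNormSq (fun _ : (UnitAddTorus (Fin 3)) => c) :=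
      setLIntegral_congr_fun measurableSet_Ioo fun τ hτ => by rw [jump_of_ne (ha.trans_lt hτ.1).ne']
    rw [this, setLIntegral_const, ENNReal.toReal_mul, toReal_eGradNormSq_const, zero_mul]
  -- `E(c) = ½‖c‖²` on the unit torus (probability space).
  have kineticEnergy_const : ∀ c : (EuclideanSpace ℝ (Fin 3)), Torus.kineticEnergy (fun _ : (UnitAddTorus (Fin 3)) => c) = 2⁻¹ * ‖c‖ ^ 2 := by
    intro c
    simp [Torus.kineticEnergy]
  -- centre of the fundamental cube
  set ctr : (EuclideanSpace ℝ (Fin 3)) := !₂[(1:ℝ)/2, 1/2, 1/2] with hctr_def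
  -- the truncated potential `χ(|z|) |z|^{1/6} e₃` (α = 5/6, W ≡ e₃)
  set Φ : (EuclideanSpace ℝ (Fin 3)) → (EuclideanSpace ℝ (Fin 3)) := fun z => (Real.smoothTransition (2 - 8 * ‖z‖) * ‖z‖ ^ (1 - 5/6 : ℝ)) • e3 with hΦ_def
  -- the untruncated potential
  set Ψ : (EuclideanSpace ℝ (Fin 3)) → (EuclideanSpace ℝ (Fin 3)) := fun z => (‖z‖ ^ (1 - 5/6 : ℝ)) • e3 with hΨ_def
  -- the debris profile read in the cube chart
  set G : (EuclideanSpace ℝ (Fin 3)) → (EuclideanSpace ℝ (Fin 3)) := fun y => Literature.Analysis.FluidPDE.curl Φ (y - ctr) with hG_def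
  -- the debris slice on the torus
  set slice : (UnitAddTorus (Fin 3)) → (EuclideanSpace ℝ (Fin 3)) := fun x => G (Torus.repr x) with hslice_def
  -- Component `0` of `curl` (by `rfl`).
  have curl_apply_zero : ∀ (v : (EuclideanSpace ℝ (Fin 3)) → (EuclideanSpace ℝ (Fin 3))) (x : (EuclideanSpace ℝ (Fin 3))), Literature.Analysis.FluidPDE.curl v x 0 =
      fderiv ℝ v x (EuclideanSpace.single 1 1) 2 - fderiv ℝ v x (EuclideanSpace.single 2 1) 1 := fun v x => rfl
  -- Component `1` of `curl` (by `rfl`).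
  have curl_apply_one : ∀ (v : (EuclideanSpace ℝ (Fin 3)) → (EuclideanSpace ℝ (Fin 3))) (x : (EuclideanSpace ℝ (Fin 3))), Literature.Analysis.FluidPDE.curl v x 1 =
      fderiv ℝ v x (EuclideanSpace.single 2 1) 0 - fderiv ℝ v x (EuclideanSpace.single 0 1) 2 := fun v x => rfl
  -- Component `2` of `curl` (by `rfl`).
  have curl_apply_two : ∀ (v : (EuclideanSpace ℝ (Fin 3)) → (EuclideanSpace ℝ (Fin 3))) (x : (EuclideanSpace ℝ (Fin 3))), Literature.Analysis.FluidPDE.curl v x 2 =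
      fderiv ℝ v x (EuclideanSpace.single 0 1) 1 - fderiv ℝ v x (EuclideanSpace.single 1 1) 0 := fun v x => rfl
  -- A map into `ℝ³` with measurable components is measurable.
  have measurable_of_apply : ∀ {f : (EuclideanSpace ℝ (Fin 3)) → (EuclideanSpace ℝ (Fin 3))}, (∀ i, Measurable fun x => f x i) → Measurable f := by
    intro f h
    have h1 : Measurable (fun x => WithLp.ofLp (f x)) := measurable_pi_iff.mpr h
    exact (WithLp.measurable_toLp 2 (Fin 3 → ℝ)).comp h1
  -- `curl v` is measurable for every `v` (measurability of `fderiv`).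
  have measurable_curl : ∀ v : (EuclideanSpace ℝ (Fin 3)) → (EuclideanSpace ℝ (Fin 3)), Measurable (Literature.Analysis.FluidPDE.curl v) := by
    intro v
    have hD : ∀ j i : Fin 3, Measurable fun x : (EuclideanSpace ℝ (Fin 3)) => fderiv ℝ v x (EuclideanSpace.single j 1) i :=
      fun j i => (EuclideanSpace.proj i).continuous.measurable.comp
        (measurable_fderiv_apply_const ℝ v (EuclideanSpace.single j 1))
    refine measurable_of_apply fun i => ?_
    fin_cases i
    · show Measurable fun x => Literature.Analysis.FluidPDE.curl v x 0
      simp only [curl_apply_zero]; exact (hD 1 2).sub (hD 2 1)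
    · show Measurable fun x => Literature.Analysis.FluidPDE.curl v x 1
      simp only [curl_apply_one]; exact (hD 2 0).sub (hD 0 2)
    · show Measurable fun x => Literature.Analysis.FluidPDE.curl v x 2
      simp only [curl_apply_two]; exact (hD 0 1).sub (hD 1 0)
  -- The debris profile is measurable.
  have measurable_G : Measurable G := (measurable_curl Φ).comp (measurable_id.sub_const ctr)
  -- Every entry of the velocity gradient is bounded by its operator norm.
  have abs_fderiv_apply_le : ∀ (v : (EuclideanSpace ℝ (Fin 3)) → (EuclideanSpace ℝ (Fin 3))) (x : (EuclideanSpace ℝ (Fin 3))) (j i : Fin 3),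
      |fderiv ℝ v x (EuclideanSpace.single j 1) i| ≤ ‖fderiv ℝ v x‖ := by
    intro v x j i
    have h1 : |fderiv ℝ v x (EuclideanSpace.single j 1) i| ≤ ‖fderiv ℝ v x (EuclideanSpace.single j 1)‖ := by
      simpa [Real.norm_eq_abs] using PiLp.norm_apply_le (fderiv ℝ v x (EuclideanSpace.single j 1)) i
    have h2 := (fderiv ℝ v x).le_opNorm (EuclideanSpace.single j 1)
    have hs : ‖(EuclideanSpace.single j (1:ℝ) : (EuclideanSpace ℝ (Fin 3)))‖ = 1 := by simp
    rw [hs, mul_one] at h2; exact h1.trans h2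
  -- `‖curl v‖ ≤ 4 ‖Dv‖`.
  have norm_curl_le : ∀ (v : (EuclideanSpace ℝ (Fin 3)) → (EuclideanSpace ℝ (Fin 3))) (x : (EuclideanSpace ℝ (Fin 3))),
      ‖Literature.Analysis.FluidPDE.curl v x‖ ≤ 4 * ‖fderiv ℝ v x‖ := by
    intro v x
    set M := ‖fderiv ℝ v x‖ with hM
    have hc : ∀ i, |Literature.Analysis.FluidPDE.curl v x i| ≤ 2 * M := by
      intro i
      fin_cases i
      · rw [show (⟨0, by norm_num⟩ : Fin 3) = 0 from rfl, curl_apply_zero]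
        exact (abs_sub _ _).trans (by linarith [abs_fderiv_apply_le v x 1 2, abs_fderiv_apply_le v x 2 1])
      · rw [show (⟨1, by norm_num⟩ : Fin 3) = 1 from rfl, curl_apply_one]
        exact (abs_sub _ _).trans (by linarith [abs_fderiv_apply_le v x 2 0, abs_fderiv_apply_le v x 0 2])
      · rw [show (⟨2, by norm_num⟩ : Fin 3) = 2 from rfl, curl_apply_two]
        exact (abs_sub _ _).trans (by linarith [abs_fderiv_apply_le v x 0 1, abs_fderiv_apply_le v x 1 0])
    have hsq : ‖Literature.Analysis.FluidPDE.curl v x‖ ^ 2 ≤ (4 * M) ^ 2 := by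
      rw [EuclideanSpace.norm_sq_eq, Fin.sum_univ_three]
      have h0 := hc 0; have h1 := hc 1; have h2 := hc 2
      simp only [Real.norm_eq_abs] at *
      have e0 := sq_abs (Literature.Analysis.FluidPDE.curl v x 0); have e1 := sq_abs (Literature.Analysis.FluidPDE.curl v x 1)
      have e2 := sq_abs (Literature.Analysis.FluidPDE.curl v x 2)
      nlinarith [abs_nonneg (Literature.Analysis.FluidPDE.curl v x 0), abs_nonneg (Literature.Analysis.FluidPDE.curl v x 1),
        abs_nonneg (Literature.Analysis.FluidPDE.curl v x 2)]
    exact (pow_le_pow_iff_left₀ (norm_nonneg _) (by positivity) two_ne_zero).mp hsq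
  -- Inside `|z| < 1/8` the cut-off equals `1`.
  have Φ_eq_Ψ : ∀ {z : (EuclideanSpace ℝ (Fin 3))} (hz : ‖z‖ < 1/8), Φ z = Ψ z := by
    intro z hz
    simp only [hΦ_def, hΨ_def]; rw [Real.smoothTransition.one_of_one_le (by linarith), one_mul]
  -- Inside `|z| < 1/8` the truncated and untruncated potentials have the same derivative.
  have fderiv_Φ_eq : ∀ {z : (EuclideanSpace ℝ (Fin 3))} (hz : ‖z‖ < 1/8), fderiv ℝ Φ z = fderiv ℝ Ψ z := by
    intro z hz
    apply Filter.EventuallyEq.fderiv_eq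
    have hmem : ball (0:(EuclideanSpace ℝ (Fin 3))) (1/8) ∈ 𝓝 z := isOpen_ball.mem_nhds (mem_ball_zero_iff.mpr hz)
    filter_upwards [hmem] with y hy; exact Φ_eq_Ψ (mem_ball_zero_iff.mp hy)
  -- Derivative of the untruncated potential off the origin.
  have hasFDerivAt_Ψ : ∀ {z : (EuclideanSpace ℝ (Fin 3))} (hz : z ≠ 0),
      HasFDerivAt Ψ ((((1:ℝ)/12 * (‖z‖ ^ 2) ^ ((1:ℝ)/12 - 1)) • ((2:ℕ) • innerSL ℝ z)).smulRight e3) z := by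
    intro z hz
    have h0 : ‖z‖ ^ 2 ≠ 0 := by positivity
    have h1 : HasFDerivAt (fun z : (EuclideanSpace ℝ (Fin 3)) => (‖z‖ ^ 2) ^ ((1:ℝ)/12))
        (((1:ℝ)/12 * (‖z‖ ^ 2) ^ ((1:ℝ)/12 - 1)) • ((2:ℕ) • innerSL ℝ z)) z := by
      have := (hasStrictFDerivAt_norm_sq z).hasFDerivAt.rpow_const (p := (1:ℝ)/12) (Or.inl h0)
      simpa using this
    have h2 : Ψ = fun z => ((‖z‖ ^ 2) ^ ((1:ℝ)/12)) • e3 := by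
      funext z; simp only [hΨ_def]; congr 1
      rw [show ((‖z‖ ^ 2 : ℝ)) = ‖z‖ ^ (2:ℝ) by norm_cast, ← Real.rpow_mul (norm_nonneg z)]; norm_num
    rw [h2]; exact h1.smul_const e3
  -- `e₁ ≠ 0`.
  have e1_ne_zero : e1 ≠ 0 := fun h0 => by simpa [he1_def] using congrArg (fun v : (EuclideanSpace ℝ (Fin 3)) => v 0) h0
  -- Admissibility of `W ≡ e₃` at `α = 5/6`: `curl(‖z‖^{1/6} e₃)(e₁) = (0,-1/6,0) ≠ 0`.
  have curl_witness_ne_zero : Literature.Analysis.FluidPDE.curl Ψ e1 ≠ 0 := by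
    intro h
    have h1 := congrArg (fun v : (EuclideanSpace ℝ (Fin 3)) => v 1) h
    simp only [Literature.Analysis.FluidPDE.curl, (hasFDerivAt_Ψ e1_ne_zero).fderiv] at h1
    simp [he1_def, he3_def, EuclideanSpace.inner_single_left] at h1
  -- `‖DΨ(z)‖ ≤ (1/6)|z|^{-5/6}` off the origin.
  have norm_fderiv_Ψ_le : ∀ {z : (EuclideanSpace ℝ (Fin 3))} (hz : z ≠ 0), ‖fderiv ℝ Ψ z‖ ≤ (1/6) * ‖z‖ ^ (-(5/6) : ℝ) := by
    intro z hz
    rw [(hasFDerivAt_Ψ hz).fderiv, ContinuousLinearMap.norm_smulRight_apply]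
    have he3 : ‖e3‖ = 1 := by simp [he3_def]
    rw [he3, mul_one, norm_smul]
    have hzpos : 0 < ‖z‖ := norm_pos_iff.mpr hz
    have hn : ‖(2:ℕ) • innerSL ℝ z‖ ≤ 2 * ‖z‖ := by
      refine norm_nsmul_le.trans ?_; rw [innerSL_apply_norm]; norm_num
    have ha : 0 ≤ (1:ℝ)/12 * (‖z‖ ^ 2) ^ ((1:ℝ)/12 - 1) := by positivity
    rw [Real.norm_of_nonneg ha]
    have key : (1:ℝ)/12 * (‖z‖ ^ 2) ^ ((1:ℝ)/12 - 1) * (2 * ‖z‖) = (1/6) * ‖z‖ ^ (-(5/6) : ℝ) := by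
      rw [show ((‖z‖ ^ 2 : ℝ)) = ‖z‖ ^ (2:ℝ) by norm_cast, ← Real.rpow_mul (norm_nonneg z)]
      rw [show (-(5/6) : ℝ) = 2 * ((1:ℝ)/12 - 1) + 1 by norm_num, Real.rpow_add hzpos, Real.rpow_one]
      ring
    calc (1:ℝ)/12 * (‖z‖ ^ 2) ^ ((1:ℝ)/12 - 1) * ‖(2:ℕ) • innerSL ℝ z‖
        ≤ (1:ℝ)/12 * (‖z‖ ^ 2) ^ ((1:ℝ)/12 - 1) * (2 * ‖z‖) := by gcongr
      _ = (1/6) * ‖z‖ ^ (-(5/6) : ℝ) := key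
  -- Near-field derivative bound `‖DΦ(z)‖ ≤ (1/6)|z|^{-5/6}` for `0 < |z| < 1/8`.
  have norm_fderiv_Φ_le_near : ∀ {z : (EuclideanSpace ℝ (Fin 3))} (hz0 : z ≠ 0) (hz : ‖z‖ < 1/8),
      ‖fderiv ℝ Φ z‖ ≤ (1/6) * ‖z‖ ^ (-(5/6) : ℝ) := by
    intro z hz0 hz
    rw [fderiv_Φ_eq hz]; exact norm_fderiv_Ψ_le hz0
  -- The truncated potential is `C¹` off the origin.
  have contDiffAt_Φ : ∀ {z : (EuclideanSpace ℝ (Fin 3))} (hz : z ≠ 0), ContDiffAt ℝ 1 Φ z := by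
    intro z hz
    have hn : ContDiffAt ℝ 1 (fun z : (EuclideanSpace ℝ (Fin 3)) => ‖z‖) z := contDiffAt_norm ℝ hz
    have h1 : ContDiffAt ℝ 1 (fun z : (EuclideanSpace ℝ (Fin 3)) => Real.smoothTransition (2 - 8 * ‖z‖)) z :=
      Real.smoothTransition.contDiff.contDiffAt.comp z (contDiffAt_const.sub (contDiffAt_const.mul hn))
    have h2 : ContDiffAt ℝ 1 (fun z : (EuclideanSpace ℝ (Fin 3)) => ‖z‖ ^ (1 - 5/6 : ℝ)) z :=
      hn.rpow_const_of_ne (norm_ne_zero_iff.mpr hz)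
    exact (h1.mul h2).smul contDiffAt_const
  -- Its derivative is continuous off the origin.
  have continuousOn_fderiv_Φ : ContinuousOn (fderiv ℝ Φ) {z : (EuclideanSpace ℝ (Fin 3)) | z ≠ 0} := by
    have h : ContDiffOn ℝ 1 Φ {z : (EuclideanSpace ℝ (Fin 3)) | z ≠ 0} := fun z hz => (contDiffAt_Φ hz).contDiffWithinAt
    exact h.continuousOn_fderiv_of_isOpen isOpen_ne le_rfl
  -- Far-field derivative bound on the compact shell `1/8 ≤ |z| ≤ 2`.
  have exists_bound_fderiv_Φ_far :
      ∃ C : ℝ, 0 ≤ C ∧ ∀ z : (EuclideanSpace ℝ (Fin 3)), 1/8 ≤ ‖z‖ → ‖z‖ ≤ 2 → ‖fderiv ℝ Φ z‖ ≤ C := by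
    set K : Set (EuclideanSpace ℝ (Fin 3)) := closedBall 0 2 ∩ {z | 1/8 ≤ ‖z‖} with hK
    have hKc : IsCompact K :=
      (isCompact_closedBall (0:(EuclideanSpace ℝ (Fin 3))) 2).inter_right (isClosed_le continuous_const continuous_norm)
    have hsub : K ⊆ {z : (EuclideanSpace ℝ (Fin 3)) | z ≠ 0} := by
      rintro z ⟨-, hz⟩ h0
      have hz' : (1:ℝ)/8 ≤ ‖z‖ := hz
      rw [h0, norm_zero] at hz'; norm_num at hz'
    obtain ⟨C, hC⟩ := hKc.exists_bound_of_continuousOn (continuousOn_fderiv_Φ.mono hsub)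
    refine ⟨max C 0, le_max_right _ _, fun z h1 h2 => (hC z ⟨mem_closedBall_zero_iff.mpr h2, h1⟩).trans (le_max_left _ _)⟩
  -- Pointwise domination of the debris profile off its centre.
  have norm_G_le : ∀ {C : ℝ} (hC0 : 0 ≤ C) (hC : ∀ z : (EuclideanSpace ℝ (Fin 3)), 1/8 ≤ ‖z‖ → ‖z‖ ≤ 2 → ‖fderiv ℝ Φ z‖ ≤ C)
      {y : (EuclideanSpace ℝ (Fin 3))} (hy : y ≠ ctr) (hy2 : ‖y - ctr‖ ≤ 2), ‖G y‖ ≤ 4 * ((1/6) * ‖y - ctr‖ ^ (-(5/6) : ℝ) + C) := by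
    intro C hC0 hC y hy hy2
    refine (norm_curl_le Φ (y - ctr)).trans ?_
    gcongr
    by_cases h : ‖y - ctr‖ < 1/8
    · exact (norm_fderiv_Φ_le_near (sub_ne_zero.mpr hy) h).trans (le_add_of_nonneg_right hC0)
    · exact (hC _ (not_lt.mp h) hy2).trans (le_add_of_nonneg_left (by positivity))
  -- Squared pointwise domination `‖G y‖² ≤ (32/36)|y-ctr|^{-5/3} + 32 C²`.
  have sq_norm_G_le : ∀ {C : ℝ} (hC0 : 0 ≤ C) (hC : ∀ z : (EuclideanSpace ℝ (Fin 3)), 1/8 ≤ ‖z‖ → ‖z‖ ≤ 2 → ‖fderiv ℝ Φ z‖ ≤ C)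
      {y : (EuclideanSpace ℝ (Fin 3))} (hy : y ≠ ctr) (hy2 : ‖y - ctr‖ ≤ 2), ‖G y‖ ^ 2 ≤ (32/36) * ‖y - ctr‖ ^ (-(5/3) : ℝ) + 32 * C ^ 2 := by
    intro C hC0 hC y hy hy2
    have h := norm_G_le hC0 hC hy hy2
    set a := ‖y - ctr‖ ^ (-(5/6) : ℝ) with ha
    have ha0 : 0 ≤ a := Real.rpow_nonneg (norm_nonneg _) _
    have hsq : a ^ 2 = ‖y - ctr‖ ^ (-(5/3) : ℝ) := by
      rw [ha, ← Real.rpow_natCast, ← Real.rpow_mul (norm_nonneg _)]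
      norm_num
    have h1 : ‖G y‖ ^ 2 ≤ (4 * ((1/6) * a + C)) ^ 2 := pow_le_pow_left₀ (norm_nonneg _) h 2
    rw [← hsq]
    nlinarith [sq_nonneg ((1/6) * a - C)]
  -- Coordinates of the centre.
  have ctr_apply : ∀ i : Fin 3, ctr i = 1/2 := by
    intro i
    fin_cases i <;> simp [hctr_def]
  -- Points of the unit cube are within distance `2` of its centre.
  have norm_sub_ctr_lt_two : ∀ {y : (EuclideanSpace ℝ (Fin 3))} (hy : y ∈ Torus.unitCube (Fin 3)), ‖y - ctr‖ < 2 := by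
    intro y hy
    have hsq : ‖y - ctr‖ ^ 2 < 2 ^ 2 := by
      rw [EuclideanSpace.norm_sq_eq, Fin.sum_univ_three]
      have hb : ∀ i, ‖(y - ctr) i‖ ^ 2 ≤ 1 := fun i => by
        have h1 := (Torus.mem_unitCube.mp hy) i
        rw [show (y - ctr) i = y i - 1/2 by simp [ctr_apply], Real.norm_eq_abs, sq_abs]; nlinarith [h1.1, h1.2]
      linarith [hb 0, hb 1, hb 2]
    exact lt_of_pow_lt_pow_left₀ 2 (by norm_num) hsq
  -- The unit cube lies in the ball of radius `2` about its centre.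
  have unitCube_subset_ball : Torus.unitCube (Fin 3) ⊆ ball ctr 2 := fun y hy => by
    rw [mem_ball, dist_eq_norm]; exact norm_sub_ctr_lt_two hy
  -- `|y - ctr|^{-5/3}` is integrable on that ball (`5/3 < 3`).
  have integrableOn_rpow_ball :
      IntegrableOn (fun y : (EuclideanSpace ℝ (Fin 3)) => ‖y - ctr‖ ^ (-(5/3) : ℝ)) (ball ctr 2) volume := by
    refine ⟨((measurable_id.sub_const ctr).norm.pow_const _).aestronglyMeasurable, ?_⟩
    have h := NewtonPotentialHolder.lintegral_ball_norm_sub_rpow_neg ctr (s := (5/3:ℝ)) (r := 2)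
      (by norm_num) (by norm_num)
    unfold HasFiniteIntegral
    calc ∫⁻ y in ball ctr 2, ‖‖y - ctr‖ ^ (-(5/3):ℝ)‖ₑ
        = ∫⁻ y in ball ctr 2, ENNReal.ofReal (‖ctr - y‖ ^ (-(5/3):ℝ)) := by
            refine lintegral_congr fun y => ?_
            rw [Real.enorm_eq_ofReal (Real.rpow_nonneg (norm_nonneg _) _), norm_sub_rev]
      _ < ⊤ := by rw [h]; exact ENNReal.ofReal_lt_top
  -- The unit cube has finite Lebesgue measure (image of the torus under `Torus.repr`).
  haveI isFiniteMeasure_restrict_unitCube :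
      IsFiniteMeasure ((volume : Measure (EuclideanSpace ℝ (Fin 3))).restrict (Torus.unitCube (Fin 3))) := by
    rw [← (Torus.measurePreserving_repr (d := Fin 3)).map_eq]; infer_instance
  -- The debris profile is square integrable on the unit cube.
  have memLp_G : MemLp G 2 ((volume : Measure (EuclideanSpace ℝ (Fin 3))).restrict (Torus.unitCube (Fin 3))) := by
    obtain ⟨C, hC0, hC⟩ := exists_bound_fderiv_Φ_far
    have hGm : AEStronglyMeasurable G ((volume : Measure (EuclideanSpace ℝ (Fin 3))).restrict (Torus.unitCube (Fin 3))) :=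
      measurable_G.aestronglyMeasurable
    rw [memLp_two_iff_integrable_sq_norm hGm]
    haveI := isFiniteMeasure_restrict_unitCube
    refine Integrable.mono' (g := fun y => (32/36) * ‖y - ctr‖ ^ (-(5/3):ℝ) + 32 * C ^ 2) ?_ ?_ ?_
    · exact ((integrableOn_rpow_ball.mono_set unitCube_subset_ball).const_mul (32/36)).add
        (integrable_const _)
    · exact (continuous_pow 2).comp_aestronglyMeasurable hGm.norm
    · have hne : ∀ᵐ y ∂(volume : Measure (EuclideanSpace ℝ (Fin 3))), y ≠ ctr := by
        have : ({ctr}ᶜ : Set (EuclideanSpace ℝ (Fin 3))) ∈ ae (volume : Measure (EuclideanSpace ℝ (Fin 3))) := compl_mem_ae_iff.mpr (measure_singleton ctr)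
        filter_upwards [this] with y hy; simpa using hy
      filter_upwards [ae_restrict_mem Torus.measurableSet_unitCube, ae_restrict_of_ae hne] with y hy hne
      rw [Real.norm_of_nonneg (sq_nonneg _)]; exact sq_norm_G_le hC0 hC hne (norm_sub_ctr_lt_two hy).le
  -- The debris slice is square integrable on the torus (`Torus.measurePreserving_repr`).
  have memLp_slice : MemLp slice 2 volume := memLp_G.comp_measurePreserving Torus.measurePreserving_repr
  -- kinetic energy of the debris slice
  set κ : ℝ := Torus.kineticEnergy slice with hκ_def
  -- It is nonnegative.
  have κ_nonneg : 0 ≤ κ := Torus.kineticEnergy_nonneg _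
  -- the constant drift with the same kinetic energy as the debris slice
  set cvec : (EuclideanSpace ℝ (Fin 3)) := Real.sqrt (2 * κ) • e1 with hcvec_def
  -- `E(cvec) = κ`.
  have kineticEnergy_cvec : Torus.kineticEnergy (fun _ : (UnitAddTorus (Fin 3)) => cvec) = κ := by
    rw [kineticEnergy_const, hcvec_def, norm_smul, Real.norm_eq_abs, abs_of_nonneg (Real.sqrt_nonneg _)]
    rw [show ‖e1‖ = 1 by simp [he1_def], mul_one, Real.sq_sqrt (by linarith [κ_nonneg])]; ring
  intro h
  have hAdm : ContDiff ℝ ((⊤ : ℕ∞) : WithTop ℕ∞) (fun _ : (EuclideanSpace ℝ (Fin 3)) => e3) ∧ ∃ y : (EuclideanSpace ℝ (Fin 3)), y ≠ 0 ∧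
      Literature.Analysis.FluidPDE.curl (fun z : (EuclideanSpace ℝ (Fin 3)) => (‖z‖ ^ (1 - (5/6 : ℝ))) • (fun _ : (EuclideanSpace ℝ (Fin 3)) => e3) (‖z‖⁻¹ • z)) y ≠ 0 := by
    exact ⟨contDiff_const, e1, e1_ne_zero, curl_witness_ne_zero⟩
  obtain ⟨q, hq, hall⟩ := h (5/6 : ℝ) (fun _ => e3) (fun _ => 0) 0 0 (by norm_num) (by norm_num) hAdm
    (Torus.isSmooth_const _)
  have hν : ∀ j : ℕ, (0:ℝ) < 1 / ((j:ℝ) + 1) := fun j => Nat.one_div_pos_of_nat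
  have key := hall (fun j => 1 / ((j:ℝ) + 1)) (fun _ => 0) (fun _ => 0) (fun _ _ => 0)
    (fun _ _ => cvec) (fun _ => jump slice cvec) hν tendsto_one_div_add_atTop_nhds_zero_nat
    (fun j => isGlobalLerayHopf_jump _ cvec memLp_slice (by rw [kineticEnergy_cvec, hκ_def]))
    ?_ ?_ ?_
  · obtain ⟨j, hj⟩ := key.exists
    simp only [show (fun (_ : ℕ) => (0:ℝ)) j + 1 = 1 by norm_num] at hj
    rw [toReal_lintegral_eGradNormSq_jump cvec le_rfl, mul_zero] at hj; exact absurd hj (not_le.mpr hq)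
  · -- `Good`: the energy inequality from the debris time `0`
    refine fun j => ⟨le_rfl, fun t ht => ?_⟩
    have hf : ∀ s : ℝ, (∫ x : (UnitAddTorus (Fin 3)), ⟪(fun _ : (UnitAddTorus (Fin 3)) => (0:(EuclideanSpace ℝ (Fin 3)))) x, jump slice cvec s x⟫) = 0 := fun s => by simp
    simp only [hf, intervalIntegral.integral_zero, add_zero]
    rcases ht.eq_or_lt with rfl | ht0
    · rw [Ioo_self, Measure.restrict_empty, lintegral_zero_measure, ENNReal.toReal_zero, mul_zero, add_zero]
    · rw [toReal_lintegral_eGradNormSq_jump cvec le_rfl, mul_zero, add_zero, jump_of_ne ht0.ne', jump_zero,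
        kineticEnergy_cvec, hκ_def]
  · -- `Bg`: the calm background is the zero field
    refine fun j => ⟨Torus.isSmooth_const _, fun x => ?_, fun y => ⟨by simp [FunctionSpaces.Torus.lift], ?_⟩⟩
    · simp [FunctionSpaces.Torus.divergence, FunctionSpaces.Torus.partialDeriv, FunctionSpaces.Torus.lineDeriv]
    · rw [show FunctionSpaces.Torus.lift (fun _ : (UnitAddTorus (Fin 3)) => (0:(EuclideanSpace ℝ (Fin 3)))) = fun _ => 0 from rfl]; simp
  · -- the debris condition with tolerance `0`: the slice IS the debris profile
    intro j
    simp only [jump_zero, sub_zero, zero_mul, ENNReal.ofReal_zero, nonpos_iff_eq_zero]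
    show eLpNorm (fun x : (UnitAddTorus (Fin 3)) => slice x - slice x) 2 volume = 0; simp
end Summit.AnomalousDissipation.AnomalousDissipation.Theorems
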